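import Summits.QuantumFields.YangMills.Theorems.ColdStartUniversalityLatticeLangevinDossSussmannVarianceDecay
import Summits.QuantumFields.YangMills.Theorems.ColdStartUniversalityLatticeLangevinWilsonExplicitGap
import Summits.QuantumFields.YangMills.Theorems.ColdStartUniversalityLatticeLangevinCocycleMain
import Summits.QuantumFields.YangMills.Theorems.ColdStartUniversalityLatticeLangevinGeneratorSymmetric
import HarnessLib

/-!
# Route `ColdStartUniversality` (fixed-cut-off package, Bakry–Émery side): the integrated curvature condition
# `ρ·ℰ(g) ≤ ∫ (𝓛g)² dμ_{β'}` IMPLIES the generator-form POINCARÉ INEQUALITY `ρ·Var_μ(F) ≤ ℰ(F)` — the semigroup proof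

Helper file (seat `ym-line-csu-p1`, g25; `--supports stmt-QuantumFields-24809`).  For the SU(2) lattice Langevin dynamics of Shen–Zhu–Zhu
on `(ℤ/L)³` at a fixed cut-off and coupling `β'`: if for some `ρ > 0` every `C³` compactly supported `g` satisfies the INTEGRATED
`CD(ρ,∞)` inequality `ρ·(−∫ (g∘coords)·𝓛g dμ_{β'}) ≤ ∫ (𝓛g)² dμ_{β'}` (hypothesis `hICD`; supplied by `…BakryEmeryCurvature` from a
Hessian bound), then for every `C³` compactly supported `f`, `F = f∘coords`,
  ★★ `wilson_generatorPoincare_of_integratedCD_compact`:  `ρ · ∫ (F − μF)² dμ_{β'} ≤ −∫ (F − μF)·𝓛f dμ_{β'}`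
(the tree's generator-form Poincaré inequality, hypothesis `hPgen` of g18/g24, with constant `ρ`).  Proof (Bakry–Émery / BGL Thm 4.8.4,
along the semigroup, no spectral theory): with `κ_t` a realising kernel family, `e(τ) = −∫ κ_τF · 𝓛F dμ = ℰ(κ_(τ/2)F)` (symmetry +
Chapman–Kolmogorov, ★ `integral_mul_transition_add`), `e' = −∫ (κ_(τ/2)𝓛F)² ≤ −ρ e` by `hICD` applied to the Dynkin-class representative
of `κ_(τ/2)F` (`transitionKernel_backwardKolmogorov`), so `e(τ) ≤ e^(−ρτ) e(0)`; the variance `w(τ) = ∫(κ_τF − μF)²` has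
`w' = −2e(2τ) ≥ −2e^(−2ρτ)ℰ(F)`, whence `w(0) ≤ ℰ(F)/ρ + w(T)` and `w(T) → 0` by the fixed-cut-off gap (`wilson_spectralGap_explicit`).
THEOREMS ONLY, no definition, no sorry.  HONEST FRAMING: fixed cut-off; the constant `ρ` is whatever `hICD` provides (volume-uniform
iff the Hessian bound is); nothing K-uniform in the route's scaling; no crux, rung or summit statement is proved; YM mass gap NOT proved.
-/

set_option autoImplicit false

noncomputable section

namespace Summit.QuantumFields.YangMills.Theorems.ColdStartUniversality

open MeasureTheory ProbabilityTheory Finset Filter Set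
open scoped BigOperators NNReal ENNReal Topology
open Literature.Probability.Process Literature.MathematicalPhysics.QuantumFieldTheory
open Literature.MathematicalPhysics.QuantumLattice (fundamentalRep fundamentalLatticeRep continuous_fundamentalRep)

variable {L : ℕ} [NeZero L]

/-- ★ **`⟨A, κ_(s+t) B⟩_μ = ⟨κ_s A, κ_t B⟩_μ`** for continuous `A, B` (symmetry of the SZZ kernels with respect to `μ_(β')` and
Chapman–Kolmogorov); in particular `⟨A, κ_(2s) A⟩ = ‖κ_s A‖²_(L²(μ)) ≥ 0`. [cite: ShenZhuZhu2022, §3 (symmetry of P_t^L, p. 13)] -/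
theorem integral_mul_transition_add (L : ℕ) [NeZero L] (β' : ℝ)
    (κ : ℝ≥0 → Kernel (GaugeConfig 3 L (Matrix.specialUnitaryGroup (Fin 2) ℂ))
      (GaugeConfig 3 L (Matrix.specialUnitaryGroup (Fin 2) ℂ))) [∀ t, IsMarkovKernel (κ t)]
    (hreal : ∀ (t : ℝ≥0) (x : GaugeConfig 3 L (Matrix.specialUnitaryGroup (Fin 2) ℂ))
        (Ω : Type) [MeasurableSpace Ω] (P : Measure Ω) [IsProbabilityMeasure P]
        (W : ℝ≥0 → Ω → (Edge 3 L × NoiseIdx 2 → ℝ)) (hW : IsFlatBrownian W P)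
        (U : ℝ≥0 → Ω → GaugeConfig 3 L (Matrix.specialUnitaryGroup (Fin 2) ℂ)),
        (∀ ω, U 0 ω = x) →
        (latticeLangevinDynamics (fundamentalLatticeRep 2) β').IsSolution (fundamentalRep (Fin 2))
          hW.natFiltration P W U →
        κ t x = P.map (U t))
    (s t : ℝ≥0) {A B : (GaugeConfig 3 L (Matrix.specialUnitaryGroup (Fin 2) ℂ)) → ℝ} (hA : Continuous A) (hB : Continuous B) :
    ∫ x, A x * (∫ y, B y ∂(κ (s + t) x)) ∂(wilsonMeasure (d := 3) (L := L) (fundamentalRep (Fin 2)) β') = ∫ x, (∫ y, A y ∂(κ s x)) * (∫ y, B y ∂(κ t x)) ∂(wilsonMeasure (d := 3) (L := L) (fundamentalRep (Fin 2)) β') := by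
  classical
  haveI := secondCountableTopology_su2
  haveI := borelSpace_config L
  have hκB : Continuous fun z => ∫ y, B y ∂(κ t z) := continuous_integral_transitionKernel L β' κ hreal t hB
  have hCK : ∀ x, ∫ y, B y ∂(κ (s + t) x) = ∫ z, (∫ y, B y ∂(κ t z)) ∂(κ s x) := by
    intro x
    rw [chapmanKolmogorov_szz β' κ hreal s t]
    haveI : IsProbabilityMeasure ((κ t ∘ₖ κ s) x) := by rw [← chapmanKolmogorov_szz β' κ hreal s t]; infer_instance
    rw [Kernel.integral_comp]
    exact hB.integrable_of_hasCompactSupport (HasCompactSupport.of_compactSpace _)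
  simp_rw [hCK]
  rw [integral_mul_transition_symm_su2 L β' κ hreal s hA hκB]
  refine integral_congr_ae (ae_of_all _ fun x => ?_)
  ring

/-- ★★ **Integrated `CD(ρ,∞)` ⇒ generator-form Poincaré, for compactly supported `C³` observables.**  If
`ρ·(−∫ (g∘coords) 𝓛g dμ_(β')) ≤ ∫ (𝓛g)² dμ_(β')` for all `C³` compactly supported `g` and `ρ > 0`, then
`ρ ∫ (F − μF)² dμ_(β') ≤ −∫ (F − μF) 𝓛f dμ_(β')` for every `C³` compactly supported `f`, `F = f∘coords`.
[cite: BakryGentilLedoux2014, Thm 4.8.4 / Prop. 4.8.3] -/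
theorem wilson_generatorPoincare_of_integratedCD_compact (L : ℕ) [NeZero L] (β' ρ : ℝ) (hρ : 0 < ρ)
    (hICD : (∀ (g : (Edge 3 L × Fin 2 × Fin 2 × Bool → ℝ) → ℝ), ContDiff ℝ 3 g → HasCompactSupport g →
      let coords : GaugeConfig 3 L (Matrix.specialUnitaryGroup (Fin 2) ℂ) → (Edge 3 L × Fin 2 × Fin 2 × Bool → ℝ) :=
      fun V q => (fun z : ℂ => if q.2.2.2 then z.im else z.re)
        ((fundamentalRep (Fin 2) (V q.1) : Matrix (Fin 2) (Fin 2) ℂ) q.2.1 q.2.2.1)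
      let gen : ((Edge 3 L × Fin 2 × Fin 2 × Bool → ℝ) → ℝ) → GaugeConfig 3 L (Matrix.specialUnitaryGroup (Fin 2) ℂ) → ℝ :=
      fun φ V =>
      (∑ i : Edge 3 L × Fin 2 × Fin 2 × Bool, fderiv ℝ φ (coords V) (Pi.single i 1) *
          (fun z : ℂ => if i.2.2.2 then z.im else z.re)
            ((latticeLangevinDynamics (fundamentalLatticeRep 2) β').drift
              (matrixConfig (fundamentalRep (Fin 2)) V) i.1 i.2.1 i.2.2.1) +
      1 / 2 * ∑ i : Edge 3 L × Fin 2 × Fin 2 × Bool, ∑ j : Edge 3 L × Fin 2 × Fin 2 × Bool,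
        fderiv ℝ (fun z => fderiv ℝ φ z (Pi.single i 1)) (coords V) (Pi.single j 1) *
          ∑ n : Edge 3 L × NoiseIdx 2,
            (if n.1 = i.1 then (fun z : ℂ => if i.2.2.2 then z.im else z.re)
              ((latticeLangevinDynamics (fundamentalLatticeRep 2) β').noise
                (matrixConfig (fundamentalRep (Fin 2)) V) i.1 n.2 i.2.1 i.2.2.1) else 0) *
            (if n.1 = j.1 then (fun z : ℂ => if j.2.2.2 then z.im else z.re)
              ((latticeLangevinDynamics (fundamentalLatticeRep 2) β').noise
                (matrixConfig (fundamentalRep (Fin 2)) V) j.1 n.2 j.2.1 j.2.2.1) else 0))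
      ρ * (-∫ V, g (coords V) * gen g V ∂(wilsonMeasure (d := 3) (L := L) (fundamentalRep (Fin 2)) β')) ≤ ∫ V, (gen g V) ^ 2 ∂(wilsonMeasure (d := 3) (L := L) (fundamentalRep (Fin 2)) β')))
    {f : (Edge 3 L × Fin 2 × Fin 2 × Bool → ℝ) → ℝ} (hf : ContDiff ℝ 3 f) (hfc : HasCompactSupport f) :
    let coords : GaugeConfig 3 L (Matrix.specialUnitaryGroup (Fin 2) ℂ) → (Edge 3 L × Fin 2 × Fin 2 × Bool → ℝ) :=
      fun V q => (fun z : ℂ => if q.2.2.2 then z.im else z.re)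
        ((fundamentalRep (Fin 2) (V q.1) : Matrix (Fin 2) (Fin 2) ℂ) q.2.1 q.2.2.1)
    let gen : ((Edge 3 L × Fin 2 × Fin 2 × Bool → ℝ) → ℝ) → GaugeConfig 3 L (Matrix.specialUnitaryGroup (Fin 2) ℂ) → ℝ :=
      fun φ V =>
      (∑ i : Edge 3 L × Fin 2 × Fin 2 × Bool, fderiv ℝ φ (coords V) (Pi.single i 1) *
          (fun z : ℂ => if i.2.2.2 then z.im else z.re)
            ((latticeLangevinDynamics (fundamentalLatticeRep 2) β').drift
              (matrixConfig (fundamentalRep (Fin 2)) V) i.1 i.2.1 i.2.2.1) +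
      1 / 2 * ∑ i : Edge 3 L × Fin 2 × Fin 2 × Bool, ∑ j : Edge 3 L × Fin 2 × Fin 2 × Bool,
        fderiv ℝ (fun z => fderiv ℝ φ z (Pi.single i 1)) (coords V) (Pi.single j 1) *
          ∑ n : Edge 3 L × NoiseIdx 2,
            (if n.1 = i.1 then (fun z : ℂ => if i.2.2.2 then z.im else z.re)
              ((latticeLangevinDynamics (fundamentalLatticeRep 2) β').noise
                (matrixConfig (fundamentalRep (Fin 2)) V) i.1 n.2 i.2.1 i.2.2.1) else 0) *
            (if n.1 = j.1 then (fun z : ℂ => if j.2.2.2 then z.im else z.re)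
              ((latticeLangevinDynamics (fundamentalLatticeRep 2) β').noise
                (matrixConfig (fundamentalRep (Fin 2)) V) j.1 n.2 j.2.1 j.2.2.1) else 0))
    ρ * ∫ V, (f (coords V) - ∫ V', f (coords V') ∂(wilsonMeasure (d := 3) (L := L) (fundamentalRep (Fin 2)) β')) ^ 2 ∂(wilsonMeasure (d := 3) (L := L) (fundamentalRep (Fin 2)) β') ≤
      -∫ V, (f (coords V) - ∫ V', f (coords V') ∂(wilsonMeasure (d := 3) (L := L) (fundamentalRep (Fin 2)) β')) * gen f V ∂(wilsonMeasure (d := 3) (L := L) (fundamentalRep (Fin 2)) β') := by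
  intro coords gen
  classical
  haveI := secondCountableTopology_su2
  haveI := borelSpace_config L
  set μ : Measure (GaugeConfig 3 L (Matrix.specialUnitaryGroup (Fin 2) ℂ)) := (wilsonMeasure (d := 3) (L := L) (fundamentalRep (Fin 2)) β') with hμ
  haveI : IsProbabilityMeasure μ :=
    isProbabilityMeasure_wilsonMeasure (d := 3) (L := L) (fundamentalRep (Fin 2)) (continuous_fundamentalRep (Fin 2)) β'
  obtain ⟨κ, hκ, -, hreal⟩ := exists_transitionKernel L β'
  haveI := hκ
  have hco : Continuous coords := continuous_coords (L := L)
  have hFc : Continuous fun V => f (coords V) := hf.continuous.comp hco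
  obtain ⟨Mf, hMf⟩ : ∃ M, ∀ V, |f (coords V)| ≤ M := by
    obtain ⟨M, hM⟩ := isCompact_univ.exists_bound_of_continuousOn hFc.continuousOn
    exact ⟨M, fun V => by simpa [Real.norm_eq_abs] using hM V (Set.mem_univ V)⟩
  -- Dynkin-class representatives of `κ_s F`
  have hBK := fun s : ℝ≥0 => transitionKernel_backwardKolmogorov (L := L) β' κ hreal hf hfc s
  choose g hg hgc hgF hcomm _hder using hBK
  -- the generator of `f` as a function on the group
  obtain ⟨genf, hgenf⟩ : ∃ genf : (GaugeConfig 3 L (Matrix.specialUnitaryGroup (Fin 2) ℂ)) → ℝ, genf = gen f := ⟨_, rfl⟩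
  have hgenfc : Continuous genf := by rw [hgenf]; exact continuous_generator (L := L) β' (hf.of_le (by norm_num))
  obtain ⟨Mg, hMg⟩ : ∃ M, ∀ V, |genf V| ≤ M := by
    obtain ⟨M, hM⟩ := isCompact_univ.exists_bound_of_continuousOn hgenfc.continuousOn
    exact ⟨M, fun V => by simpa [Real.norm_eq_abs] using hM V (Set.mem_univ V)⟩
  have hgen0 : ∫ x, genf x ∂μ = 0 := by rw [hgenf]; exact integral_generator_wilson_eq_zero L β' hf hfc
  have hgF' : ∀ (s : ℝ≥0) (x : (GaugeConfig 3 L (Matrix.specialUnitaryGroup (Fin 2) ℂ))), ∫ y, f (coords y) ∂(κ s x) = g s (coords x) := fun s x => hgF s x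
  have hcomm' : ∀ (s : ℝ≥0) (x : (GaugeConfig 3 L (Matrix.specialUnitaryGroup (Fin 2) ℂ))), gen (g s) x = ∫ y, genf y ∂(κ s x) := fun s x => by
    rw [hgenf]; exact hcomm s x
  have hICD' : ∀ s : ℝ≥0, ρ * (-∫ V, g s (coords V) * gen (g s) V ∂μ) ≤ ∫ V, (gen (g s) V) ^ 2 ∂μ :=
    fun s => hICD (g s) (hg s) (hgc s)
  -- `PF τ = κ_τ F`, `PG τ = κ_τ 𝓛F`
  obtain ⟨PF, hPF⟩ : ∃ PF : ℝ → (GaugeConfig 3 L (Matrix.specialUnitaryGroup (Fin 2) ℂ)) → ℝ, PF = fun τ x => ∫ y, f (coords y) ∂(κ τ.toNNReal x) := ⟨_, rfl⟩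
  obtain ⟨PG, hPG⟩ : ∃ PG : ℝ → (GaugeConfig 3 L (Matrix.specialUnitaryGroup (Fin 2) ℂ)) → ℝ, PG = fun τ x => ∫ y, genf y ∂(κ τ.toNNReal x) := ⟨_, rfl⟩
  set m₀ : ℝ := ∫ z, f (coords z) ∂μ with hm₀
  have hPFb : ∀ τ x, |PF τ x| ≤ Mf := fun τ x => by
    rw [hPF]
    haveI : IsProbabilityMeasure (κ τ.toNNReal x) := IsMarkovKernel.isProbabilityMeasure x
    refine (abs_integral_le_integral_abs).trans ?_
    calc ∫ y, |f (coords y)| ∂(κ τ.toNNReal x) ≤ ∫ _y, Mf ∂(κ τ.toNNReal x) :=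
          integral_mono (integrable_of_continuous_of_compactSpace (continuous_abs.comp hFc) _)
            (integrable_const _) fun y => hMf y
      _ = Mf := by simp
  have hPGb : ∀ τ x, |PG τ x| ≤ Mg := fun τ x => by
    rw [hPG]
    haveI : IsProbabilityMeasure (κ τ.toNNReal x) := IsMarkovKernel.isProbabilityMeasure x
    refine (abs_integral_le_integral_abs).trans ?_
    calc ∫ y, |genf y| ∂(κ τ.toNNReal x) ≤ ∫ _y, Mg ∂(κ τ.toNNReal x) :=
          integral_mono (integrable_of_continuous_of_compactSpace (continuous_abs.comp hgenfc) _)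
            (integrable_const _) fun y => hMg y
      _ = Mg := by simp
  have hPFcx : ∀ τ, Continuous fun x => PF τ x := fun τ => by
    rw [hPF]; exact continuous_integral_transitionKernel L β' κ hreal τ.toNNReal hFc
  have hPGcx : ∀ τ, Continuous fun x => PG τ x := fun τ => by
    rw [hPG]; exact continuous_integral_transitionKernel L β' κ hreal τ.toNNReal hgenfc
  have hPFct : ∀ x, Continuous fun τ => PF τ x := fun x => by
    rw [hPF]
    exact (continuous_transitionKernel_action (L := L) β' κ hreal hFc).comp
      (continuous_real_toNNReal.prodMk continuous_const)
  have hPGct : ∀ x, Continuous fun τ => PG τ x := fun x => by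
    rw [hPG]
    exact (continuous_transitionKernel_action (L := L) β' κ hreal hgenfc).comp
      (continuous_real_toNNReal.prodMk continuous_const)
  have hPFder : ∀ x {τ : ℝ}, 0 < τ → HasDerivAt (fun τ => PF τ x) (PG τ x) τ := fun x τ hτ => by
    have hDf := fun {σ : ℝ} (hσ : (0 : ℝ) ≤ σ) => transitionKernel_dynkin (L := L) β' κ hreal hf hfc x hσ
    have ha : Continuous fun r : ℝ => PG r x := hPGct x
    have hder : HasDerivAt (fun σ : ℝ => f (coords x) + ∫ r in (0 : ℝ)..σ, PG r x) (PG τ x) τ :=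
      ((intervalIntegral.integral_hasDerivAt_right (ha.intervalIntegrable _ _)
        (ha.stronglyMeasurableAtFilter _ _) ha.continuousAt)).const_add _
    refine hder.congr_of_eventuallyEq ?_
    filter_upwards [Ioi_mem_nhds hτ] with σ hσ
    have e := hDf (le_of_lt hσ)
    rw [hPF, hPG, hgenf]
    exact e
  have hinv : ∀ τ, ∫ x, PF τ x ∂μ = m₀ := fun τ => by
    rw [hPF, hm₀]
    exact integral_transitionKernel_integral_eq_wilson (L := L) β' κ hreal τ.toNNReal hFc.measurable ⟨Mf, hMf⟩
  have hinvG : ∀ τ, ∫ x, PG τ x ∂μ = 0 := fun τ => by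
    rw [hPG, ← hgen0]
    exact integral_transitionKernel_integral_eq_wilson (L := L) β' κ hreal τ.toNNReal hgenfc.measurable ⟨Mg, hMg⟩
  -- the energy along the flow: `e(τ) = −∫ κ_τF · 𝓛F dμ`
  obtain ⟨e, he⟩ : ∃ e : ℝ → ℝ, e = fun τ => -∫ x, PF τ x * genf x ∂μ := ⟨_, rfl⟩
  -- symmetry identities: for `s ≥ 0`, `e(2s) = ℰ(g_s)` and `∫ κ_(2s)𝓛F · 𝓛F = ∫ (𝓛(g_s∘coords))²`
  have hnn : ∀ s : ℝ≥0, ((s : ℝ) + s).toNNReal = s + s := by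
    intro s; rw [← NNReal.coe_add, Real.toNNReal_coe]
  have he2 : ∀ s : ℝ≥0, e ((s : ℝ) + s) = -∫ x, g s (coords x) * gen (g s) x ∂μ := by
    intro s
    rw [he]
    simp only [hPF, hnn]
    congr 1
    calc ∫ x, (∫ y, f (coords y) ∂(κ (s + s) x)) * genf x ∂μ
        = ∫ x, genf x * (∫ y, f (coords y) ∂(κ (s + s) x)) ∂μ := integral_congr_ae (ae_of_all _ fun x => mul_comm _ _)
      _ = ∫ x, f (coords x) * (∫ y, genf y ∂(κ (s + s) x)) ∂μ := integral_mul_transition_symm_su2 L β' κ hreal (s + s) hgenfc hFc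
      _ = ∫ x, (∫ y, f (coords y) ∂(κ s x)) * (∫ y, genf y ∂(κ s x)) ∂μ :=
          integral_mul_transition_add L β' κ hreal s s hFc hgenfc
      _ = ∫ x, g s (coords x) * gen (g s) x ∂μ :=
          integral_congr_ae (ae_of_all _ fun x => by beta_reduce; rw [hgF' s x, hcomm' s x])
  have hsq : ∀ s : ℝ≥0, ∫ x, PG ((s : ℝ) + s) x * genf x ∂μ = ∫ x, (gen (g s) x) ^ 2 ∂μ := by
    intro s
    simp only [hPG, hnn]
    calc ∫ x, (∫ y, genf y ∂(κ (s + s) x)) * genf x ∂μ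
        = ∫ x, genf x * (∫ y, genf y ∂(κ (s + s) x)) ∂μ := integral_congr_ae (ae_of_all _ fun x => mul_comm _ _)
      _ = ∫ x, (∫ y, genf y ∂(κ s x)) * (∫ y, genf y ∂(κ s x)) ∂μ := integral_mul_transition_add L β' κ hreal s s hgenfc hgenfc
      _ = ∫ x, (gen (g s) x) ^ 2 ∂μ := integral_congr_ae (ae_of_all _ fun x => by beta_reduce; rw [← hcomm' s x, sq])
  -- continuity of `e` and its derivative on `(0,∞)`
  have hec : Continuous e := by
    rw [he]
    refine (continuous_of_dominated (bound := fun _ => Mf * Mg) (fun τ => ?_) (fun τ => ?_)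
      (integrable_const _) (ae_of_all _ fun x => ?_)).neg
    · exact ((hPFcx τ).mul hgenfc).aestronglyMeasurable
    · refine ae_of_all _ fun x => ?_
      rw [Real.norm_eq_abs, abs_mul]
      exact mul_le_mul (hPFb τ x) (hMg x) (abs_nonneg _) ((abs_nonneg _).trans (hPFb τ x))
    · exact (hPFct x).mul continuous_const
  have heder : ∀ τ, 0 < τ → HasDerivAt e (-∫ x, PG τ x * genf x ∂μ) τ := by
    intro τ hτ
    rw [he]
    have hs : Ioi (τ / 2) ∈ 𝓝 τ := Ioi_mem_nhds (by linarith)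
    refine (hasDerivAt_integral_of_dominated_loc_of_deriv_le (μ := μ) (x₀ := τ)
      (F := fun σ x => PF σ x * genf x) (F' := fun σ x => PG σ x * genf x)
      (bound := fun _ => Mg * Mg) hs ?_ ?_ ?_ ?_ (integrable_const _) ?_).2.neg
    · exact Filter.Eventually.of_forall fun σ => ((hPFcx σ).mul hgenfc).aestronglyMeasurable
    · exact integrable_of_continuous_of_compactSpace ((hPFcx τ).mul hgenfc) _
    · exact ((hPGcx τ).mul hgenfc).aestronglyMeasurable
    · refine ae_of_all _ fun x σ _ => ?_
      rw [Real.norm_eq_abs, abs_mul]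
      exact mul_le_mul (hPGb σ x) (hMg x) (abs_nonneg _) ((abs_nonneg _).trans (hPGb σ x))
    · refine ae_of_all _ fun x σ hσ => ?_
      have hσ0 : 0 < σ := lt_trans (by linarith) hσ
      exact (hPFder x hσ0).mul_const _
  -- the differential inequality `e' ≤ −ρ e`
  have hedi : ∀ τ, 0 < τ → -∫ x, PG τ x * genf x ∂μ ≤ -ρ * e τ := by
    intro τ hτ
    set s : ℝ≥0 := (τ / 2).toNNReal with hs
    have hτs : τ = (s : ℝ) + s := by rw [hs, Real.coe_toNNReal _ (by linarith)]; ring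
    rw [hτs, hsq s, he2 s]
    have h := hICD' s
    linarith
  have hegron : ∀ τ, 0 ≤ τ → e τ ≤ Real.exp (-ρ * τ) * e 0 := fun τ hτ =>
    le_exp_mul_of_hasDerivAt_le (c := ρ) hec.continuousOn heder hedi hτ
  -- the variance along the flow
  obtain ⟨w, hw⟩ : ∃ w : ℝ → ℝ, w = fun τ => ∫ x, (PF τ x - m₀) * (PF τ x - m₀) ∂μ := ⟨_, rfl⟩
  have hB : ∀ τ x, |PF τ x - m₀| ≤ Mf + |m₀| := fun τ x => (abs_sub _ _).trans (by linarith [hPFb τ x])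
  have hwc : Continuous w := by
    rw [hw]
    refine continuous_of_dominated (bound := fun _ => (Mf + |m₀|) * (Mf + |m₀|)) (fun τ => ?_) (fun τ => ?_)
      (integrable_const _) (ae_of_all _ fun x => ?_)
    · exact (((hPFcx τ).sub continuous_const).mul ((hPFcx τ).sub continuous_const)).aestronglyMeasurable
    · refine ae_of_all _ fun x => ?_
      rw [Real.norm_eq_abs, abs_mul]
      exact mul_le_mul (hB τ x) (hB τ x) (abs_nonneg _) ((abs_nonneg _).trans (hB τ x))
    · exact ((hPFct x).sub continuous_const).mul ((hPFct x).sub continuous_const)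
  have hwder : ∀ τ, 0 < τ → HasDerivAt w (∫ x, (PG τ x * (PF τ x - m₀) + (PF τ x - m₀) * PG τ x) ∂μ) τ := by
    intro τ hτ
    rw [hw]
    have hs : Ioi (τ / 2) ∈ 𝓝 τ := Ioi_mem_nhds (by linarith)
    refine (hasDerivAt_integral_of_dominated_loc_of_deriv_le (μ := μ) (x₀ := τ)
      (F := fun σ x => (PF σ x - m₀) * (PF σ x - m₀))
      (F' := fun σ x => PG σ x * (PF σ x - m₀) + (PF σ x - m₀) * PG σ x)
      (bound := fun _ => 2 * (Mg * (Mf + |m₀|))) hs ?_ ?_ ?_ ?_ (integrable_const _) ?_).2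
    · exact Filter.Eventually.of_forall fun σ =>
        (((hPFcx σ).sub continuous_const).mul ((hPFcx σ).sub continuous_const)).aestronglyMeasurable
    · exact integrable_of_continuous_of_compactSpace
        (((hPFcx τ).sub continuous_const).mul ((hPFcx τ).sub continuous_const)) _
    · exact (((hPGcx τ).mul ((hPFcx τ).sub continuous_const)).add
        (((hPFcx τ).sub continuous_const).mul (hPGcx τ))).aestronglyMeasurable
    · refine ae_of_all _ fun x σ _ => ?_
      rw [Real.norm_eq_abs]
      refine (abs_add_le _ _).trans ?_
      rw [abs_mul, abs_mul, two_mul]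
      exact add_le_add (mul_le_mul (hPGb σ x) (hB σ x) (abs_nonneg _) ((abs_nonneg _).trans (hPGb σ x)))
        (by rw [mul_comm]; exact mul_le_mul (hPGb σ x) (hB σ x) (abs_nonneg _) ((abs_nonneg _).trans (hPGb σ x)))
    · refine ae_of_all _ fun x σ hσ => ?_
      have hσ0 : 0 < σ := lt_trans (by linarith) hσ
      exact ((hPFder x hσ0).sub_const m₀).mul ((hPFder x hσ0).sub_const m₀)
  -- `w'(τ) = −2 e(2τ) ≥ −2 e^(−2ρτ) e(0)`
  have hwder_eq : ∀ τ, 0 < τ → ∫ x, (PG τ x * (PF τ x - m₀) + (PF τ x - m₀) * PG τ x) ∂μ = -2 * e (τ + τ) := by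
    intro τ hτ
    have h1 : ∫ x, (PG τ x * (PF τ x - m₀) + (PF τ x - m₀) * PG τ x) ∂μ = 2 * ∫ x, PF τ x * PG τ x ∂μ - 2 * m₀ * ∫ x, PG τ x ∂μ := by
      have hi1 : Integrable (fun x => PF τ x * PG τ x) μ := integrable_of_continuous_of_compactSpace ((hPFcx τ).mul (hPGcx τ)) _
      have hi2 : Integrable (fun x => PG τ x) μ := integrable_of_continuous_of_compactSpace (hPGcx τ) _
      rw [← integral_const_mul, ← integral_const_mul, ← integral_sub (hi1.const_mul _) (hi2.const_mul _)]
      refine integral_congr_ae (ae_of_all _ fun x => ?_)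
      ring
    have h2 : ∫ x, PF τ x * PG τ x ∂μ = -e (τ + τ) := by
      set s : ℝ≥0 := τ.toNNReal with hs
      have hτs : (s : ℝ) = τ := Real.coe_toNNReal _ hτ.le
      rw [he]
      simp only [hPF, hPG, neg_neg]
      rw [show (τ + τ).toNNReal = s + s by rw [← hτs, hnn s], show τ.toNNReal = s from rfl]
      rw [← integral_mul_transition_add L β' κ hreal s s hFc hgenfc,
        integral_mul_transition_symm_su2 L β' κ hreal (s + s) hFc hgenfc]
      refine integral_congr_ae (ae_of_all _ fun x => ?_)
      ring
    rw [h1, h2, hinvG τ]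
    ring
  -- `M(τ) = w(τ) − (e 0/ρ) e^(−2ρτ)` is non-decreasing
  have hmono : MonotoneOn (fun τ => w τ - e 0 / ρ * Real.exp (-(2 * ρ) * τ)) (Ici 0) := by
    have hMc : ContinuousOn (fun τ => w τ - e 0 / ρ * Real.exp (-(2 * ρ) * τ)) (Ici 0) :=
      (hwc.sub (continuous_const.mul (Real.continuous_exp.comp (continuous_const.mul continuous_id)))).continuousOn
    have hMd : ∀ τ, 0 < τ → HasDerivAt (fun τ => w τ - e 0 / ρ * Real.exp (-(2 * ρ) * τ))
        (∫ x, (PG τ x * (PF τ x - m₀) + (PF τ x - m₀) * PG τ x) ∂μ - e 0 / ρ * (Real.exp (-(2 * ρ) * τ) * (-(2 * ρ) * 1))) τ :=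
      fun τ hτ => (hwder τ hτ).sub ((((hasDerivAt_id τ).const_mul (-(2 * ρ))).exp).const_mul _)
    refine monotoneOn_of_deriv_nonneg (convex_Ici 0) hMc (fun τ hτ => ?_) (fun τ hτ => ?_)
    · rw [interior_Ici] at hτ
      exact (hMd τ hτ).differentiableAt.differentiableWithinAt
    · rw [interior_Ici] at hτ
      have hτ' : 0 < τ := hτ
      rw [(hMd τ hτ').deriv, hwder_eq τ hτ']
      have hE : e (τ + τ) ≤ Real.exp (-(2 * ρ) * τ) * e 0 := by
        have h := hegron (τ + τ) (by linarith)
        rwa [show -ρ * (τ + τ) = -(2 * ρ) * τ by ring] at h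
      have hρ0 : ρ ≠ 0 := hρ.ne'
      have hkey : e 0 / ρ * (Real.exp (-(2 * ρ) * τ) * (-(2 * ρ) * 1)) = -2 * (Real.exp (-(2 * ρ) * τ) * e 0) := by
        field_simp
      rw [hkey]
      linarith
  -- hence `w 0 ≤ e 0 / ρ + w T` for every `T ≥ 0`
  have hwT : ∀ T, 0 ≤ T → w 0 ≤ e 0 / ρ + w T := by
    intro T hT
    have h := hmono (self_mem_Ici) (show T ∈ Ici (0 : ℝ) from hT) hT
    simp only [mul_zero, Real.exp_zero, mul_one] at h
    have hpos : 0 ≤ e 0 / ρ * Real.exp (-(2 * ρ) * T) := by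
      have he0 : 0 ≤ e 0 := by
        have h2 := he2 0
        simp only [NNReal.coe_zero, add_zero] at h2
        rw [h2]
        have hnp : ∫ V, g 0 (coords V) * gen (g 0) V ∂μ ≤ 0 := integral_mul_generator_self_nonpos L β' (hg 0) (hgc 0)
        linarith
      exact mul_nonneg (div_nonneg he0 hρ.le) (Real.exp_pos _).le
    linarith
  -- and `w T → 0` by the fixed-cut-off spectral gap
  have hw0 : w 0 = ∫ x, (f (coords x) - m₀) ^ 2 ∂μ := by
    have hκ0 : κ 0 = Kernel.id := transitionKernel_zero_eq_id (L := L) (β' := β') κ hreal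
    rw [hw]
    refine integral_congr_ae (ae_of_all _ fun x => ?_)
    have h0 : PF 0 x = f (coords x) := by
      rw [hPF]
      show ∫ y, f (coords y) ∂(κ (0 : ℝ).toNNReal x) = f (coords x)
      rw [Real.toNNReal_zero, hκ0, Kernel.id_apply, integral_dirac' _ _ hFc.measurable.stronglyMeasurable]
    simp only [h0, sq]
  have hwdecay : ∀ T : ℝ≥0, w T ≤ Real.exp (-2 * ((3 / 2 : ℝ) * Real.exp (-(|β'| * (4 * (Fintype.card (Plaquette 3 L) : ℝ))))) * T) * w 0 := by
    intro T
    have h := wilson_spectralGap_explicit L β' κ hreal hFc T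
    have hwT' : w T = ∫ x, ((∫ y, f (coords y) ∂(κ T x)) - m₀) ^ 2 ∂μ := by
      rw [hw]; refine integral_congr_ae (ae_of_all _ fun x => ?_)
      rw [hPF]; simp only [Real.toNNReal_coe, sq]
    rw [hwT', hw0]
    exact h
  have hw0le : w 0 ≤ e 0 / ρ := by
    set lam : ℝ := (3 / 2 : ℝ) * Real.exp (-(|β'| * (4 * (Fintype.card (Plaquette 3 L) : ℝ)))) with hlam
    have hlam_pos : 0 < lam := wilson_explicitGap_pos L β'
    have htend : Tendsto (fun T : ℝ => Real.exp (-2 * lam * T) * w 0) atTop (𝓝 0) := by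
      have h1 : Tendsto (fun T : ℝ => -2 * lam * T) atTop atBot := tendsto_id.const_mul_atTop_of_neg (by linarith)
      have h2 : Tendsto (fun T : ℝ => Real.exp (-2 * lam * T)) atTop (𝓝 0) := Real.tendsto_exp_atBot.comp h1
      simpa using h2.mul_const (w 0)
    refine le_of_forall_pos_lt_add fun ε hε => ?_
    have hev := (htend.eventually (Metric.ball_mem_nhds (0 : ℝ) hε)).and (eventually_ge_atTop 0)
    obtain ⟨T, hT1, hT2⟩ := hev.exists
    rw [Real.dist_eq, sub_zero] at hT1
    have h1 := hwT T hT2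
    have h2 := hwdecay T.toNNReal
    rw [Real.coe_toNNReal _ hT2] at h2
    have h3 : Real.exp (-2 * lam * T) * w 0 < ε := lt_of_abs_lt hT1
    linarith
  -- conclusion
  have hE0 : e 0 = -∫ V, (f (coords V) - m₀) * gen f V ∂μ := by
    have hκ0 : κ 0 = Kernel.id := transitionKernel_zero_eq_id (L := L) (β' := β') κ hreal
    rw [he]
    have h0 : ∀ x, PF 0 x = f (coords x) := fun x => by
      rw [hPF]
      show ∫ y, f (coords y) ∂(κ (0 : ℝ).toNNReal x) = f (coords x)
      rw [Real.toNNReal_zero, hκ0, Kernel.id_apply, integral_dirac' _ _ hFc.measurable.stronglyMeasurable]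
    simp_rw [h0]
    congr 1
    have hi1 : Integrable (fun x => f (coords x) * genf x) μ := integrable_of_continuous_of_compactSpace (hFc.mul hgenfc) _
    have hi2 : Integrable (fun x => genf x) μ := integrable_of_continuous_of_compactSpace hgenfc _
    rw [show (fun V => (f (coords V) - m₀) * gen f V) = fun V => f (coords V) * genf V - m₀ * genf V from
      funext fun V => by rw [hgenf]; ring, integral_sub hi1 (hi2.const_mul _), integral_const_mul, hgen0, mul_zero, sub_zero]
  rw [← hw0, ← hE0]
  have := mul_le_mul_of_nonneg_left hw0le hρ.le
  rwa [mul_div_cancel₀ _ hρ.ne'] at this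

end Summit.QuantumFields.YangMills.Theorems.ColdStartUniversality
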